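import Mathlib

/-!
# Crux `PolyMobiusTail` (stmt-Parity-0870), line `eta-free-multilinear-window`, stub `stub_pair_middle`
# — helper 3: real-arithmetic bookkeeping of the boxes part

Pure inequalities in the parameters `L = 1 + log x`, `κ = L^{-kκ}`, the constants `Csh, Cτ, K` and the step
counts, isolating the final bookkeeping of `boxes_part_le`. Head: the registered auxiliary stub
`stub_pair_middle_arith`.
-/

open Finset Real

namespace Summit.Parity.BatemanHorn.Theorems.PolyMobiusTail.EtaFreeWindow

namespace MiddleAssembly

/-- Arithmetic of the shell terms: `Csh (2κ x (log x)^6 + x/(log x)^3) ≤ 10 Csh x / L³` when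
`κ L^6 L^3 ≤ 1`, `log x ≤ L ≤ 2 log x`, `1 ≤ log x`. -/
theorem sh_term_le {Csh κ x L : ℝ} (hCsh : 0 ≤ Csh) (hκ0 : 0 ≤ κ) (hx0 : 0 ≤ x) (hlog1 : 1 ≤ Real.log x)
    (hlogL : Real.log x ≤ L) (hLlog : L ≤ 2 * Real.log x) (hκL6 : κ * L ^ 6 * L ^ 3 ≤ 1) :
    Csh * (2 * κ * x * Real.log x ^ (3 + 3) + x / Real.log x ^ 3) ≤ 10 * Csh * x / L ^ 3 := by
  have hlog0 : 0 ≤ Real.log x := by linarith only [hlog1]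
  have hL0 : 0 < L := by linarith only [hlog1, hlogL]
  have hL3 : 0 < L ^ 3 := by positivity
  have hlog3pos : 0 < Real.log x ^ 3 := by positivity
  have hlogpow6 : Real.log x ^ (3 + 3) ≤ L ^ 6 := by
    rw [show 3 + 3 = 6 by norm_num]; exact pow_le_pow_left₀ hlog0 hlogL 6
  have hlogpow3 : L ^ 3 ≤ 8 * Real.log x ^ 3 := by
    have : L ^ 3 ≤ (2 * Real.log x) ^ 3 := pow_le_pow_left₀ hL0.le hLlog 3
    nlinarith only [this]
  have h1 : 2 * κ * x * Real.log x ^ (3 + 3) ≤ 2 * x / L ^ 3 := by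
    rw [le_div_iff₀ hL3]
    have h0 : 0 ≤ 2 * κ * x := by positivity
    have h2 : 2 * κ * x * Real.log x ^ (3 + 3) * L ^ 3 ≤ 2 * κ * x * L ^ 6 * L ^ 3 :=
      mul_le_mul_of_nonneg_right (mul_le_mul_of_nonneg_left hlogpow6 h0) hL3.le
    have h3 : 2 * κ * x * L ^ 6 * L ^ 3 = 2 * x * (κ * L ^ 6 * L ^ 3) := by ring
    have h4 : 2 * x * (κ * L ^ 6 * L ^ 3) ≤ 2 * x * 1 := mul_le_mul_of_nonneg_left hκL6 (by positivity)
    linarith only [h2, h3.le, h4]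
  have h2 : x / Real.log x ^ 3 ≤ 8 * x / L ^ 3 := by
    rw [div_le_div_iff₀ hlog3pos hL3]
    have := mul_le_mul_of_nonneg_left hlogpow3 hx0
    linarith only [this]
  have h3 : Csh * (2 * κ * x * Real.log x ^ (3 + 3) + x / Real.log x ^ 3) ≤ Csh * (2 * x / L ^ 3 + 8 * x / L ^ 3) :=
    mul_le_mul_of_nonneg_left (add_le_add h1 h2) hCsh
  have h4 : Csh * (2 * x / L ^ 3 + 8 * x / L ^ 3) = 10 * Csh * x / L ^ 3 := by ring
  linarith only [h3, h4.le]

/-- Arithmetic of the short-interval term: `Cτ (y (log x)^c + x^{3/4}) ≤ Cτ (4x/L³ + L^c + x^{3/4})` when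
`y ≤ 4κx + 1`, `κ L^c L³ ≤ 1`, `0 ≤ log x ≤ L`. -/
theorem tau_term_le {Cτ κ x L y : ℝ} {c : ℕ} (hCτ : 0 ≤ Cτ) (hκ0 : 0 ≤ κ) (hx0 : 0 ≤ x)
    (hlog0 : 0 ≤ Real.log x) (hlogL : Real.log x ≤ L) (hL0 : 0 < L) (hyle : y ≤ 4 * κ * x + 1)
    (hκLc : κ * L ^ c * L ^ 3 ≤ 1) :
    Cτ * (y * Real.log x ^ c + x ^ (3 / 4 : ℝ)) ≤ Cτ * (4 * x / L ^ 3 + L ^ c + x ^ (3 / 4 : ℝ)) := by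
  have hL3 : 0 < L ^ 3 := by positivity
  have hlogpowc : Real.log x ^ c ≤ L ^ c := pow_le_pow_left₀ hlog0 hlogL c
  refine mul_le_mul_of_nonneg_left (add_le_add ?_ le_rfl) hCτ
  have h1 : y * Real.log x ^ c ≤ (4 * κ * x + 1) * L ^ c := mul_le_mul hyle hlogpowc (by positivity) (by positivity)
  have h2 : 4 * κ * x * L ^ c ≤ 4 * x / L ^ 3 := by
    rw [le_div_iff₀ hL3]
    have h3 : 4 * κ * x * L ^ c * L ^ 3 = 4 * x * (κ * L ^ c * L ^ 3) := by ring
    rw [h3]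
    have := mul_le_mul_of_nonneg_left hκLc (show 0 ≤ 4 * x by positivity)
    linarith only [this]
  nlinarith only [h1, h2]

/-- Final bookkeeping of the shell part: `9L² (20 Csh x/L³ + Cτ(4x/L³ + L^c + x^{3/4})) ≤
(180 Csh + 36 Cτ)(x/L) + 18 Cτ L^{2k+6} x^{1-ν}` (`1 ≤ x^{1-ν}`, `x^{3/4} ≤ x^{1-ν}`, `c ≤ k`, `L ≥ 1`). -/
theorem shell_total_arith {Csh Cτ x L ν : ℝ} {c kκ : ℕ} (hCτ : 0 ≤ Cτ) (hL1 : 1 ≤ L) (hx0 : 0 ≤ x)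
    (hxν1 : 1 ≤ x ^ (1 - ν)) (hx34 : x ^ (3 / 4 : ℝ) ≤ x ^ (1 - ν)) (hck : c + 2 ≤ 2 * kκ + 6) :
    9 * L ^ 2 * (10 * Csh * x / L ^ 3 + 10 * Csh * x / L ^ 3 + Cτ * (4 * x / L ^ 3 + L ^ c + x ^ (3 / 4 : ℝ))) ≤
      (180 * Csh + 36 * Cτ) * (x / L) + 18 * Cτ * (L ^ (2 * kκ + 6) * x ^ (1 - ν)) := by
  have hL0 : 0 < L := by linarith only [hL1]
  have hLc2 : L ^ 2 * L ^ c ≤ L ^ (2 * kκ + 6) := by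
    rw [← pow_add]; exact pow_le_pow_right₀ hL1 (by omega)
  have hL2 : L ^ 2 ≤ L ^ (2 * kκ + 6) := pow_le_pow_right₀ hL1 (by omega)
  have hLx : 9 * L ^ 2 * (10 * Csh * x / L ^ 3 + 10 * Csh * x / L ^ 3 + Cτ * (4 * x / L ^ 3)) =
      (180 * Csh + 36 * Cτ) * (x / L) := by
    field_simp
    ring
  have hrest : 9 * L ^ 2 * (Cτ * (L ^ c + x ^ (3 / 4 : ℝ))) ≤ 18 * Cτ * (L ^ (2 * kκ + 6) * x ^ (1 - ν)) := by
    have hp : 0 ≤ L ^ (2 * kκ + 6) := by positivity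
    have h2 : L ^ 2 * L ^ c ≤ L ^ (2 * kκ + 6) * x ^ (1 - ν) := by
      calc L ^ 2 * L ^ c ≤ L ^ (2 * kκ + 6) := hLc2
        _ = L ^ (2 * kκ + 6) * 1 := (mul_one _).symm
        _ ≤ L ^ (2 * kκ + 6) * x ^ (1 - ν) := mul_le_mul_of_nonneg_left hxν1 hp
    have hx0' : 0 ≤ x ^ (3 / 4 : ℝ) := Real.rpow_nonneg hx0 _
    have h3 : L ^ 2 * x ^ (3 / 4 : ℝ) ≤ L ^ (2 * kκ + 6) * x ^ (1 - ν) :=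
      mul_le_mul hL2 hx34 hx0' hp
    nlinarith only [h2, h3, hCτ]
  have hsplit : 9 * L ^ 2 * (10 * Csh * x / L ^ 3 + 10 * Csh * x / L ^ 3 + Cτ * (4 * x / L ^ 3 + L ^ c + x ^ (3 / 4 : ℝ))) =
      9 * L ^ 2 * (10 * Csh * x / L ^ 3 + 10 * Csh * x / L ^ 3 + Cτ * (4 * x / L ^ 3)) +
      9 * L ^ 2 * (Cτ * (L ^ c + x ^ (3 / 4 : ℝ))) := by ring
  rw [hsplit, hLx]
  linarith only [hrest]

/-- Final bookkeeping of the dispersion part: `SP·SM·K·Dunif ≤ 100K(x/L) + 25K(4+4√(2q))·L^{2k+6}x^{1-ν}`. -/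
theorem disp_total_arith {SP SM K L κ x q ν : ℝ} {kκ : ℕ} {Ad : ℝ} (hK : 0 ≤ K) (hL1 : 1 ≤ L)
    (hκ0 : 0 ≤ κ) (hκ1 : κ ≤ 1) (hx0 : 0 < x) (hSM0 : 0 ≤ SM)
    (hSPle : SP ≤ 5 * L ^ (kκ + 1)) (hSMle : SM ≤ 5 * L ^ (kκ + 1)) (hLAd : L ^ Ad = L ^ (2 * kκ + 4)) :
    SP * (SM * (K * (3 * L ^ 4 * x ^ (1 - ν) + 4 * κ * x / L ^ Ad + (4 * Real.sqrt (2 * q) + 1) * x ^ (1 - ν)))) ≤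
      100 * K * (x / L) + (25 * K * (4 + 4 * Real.sqrt (2 * q))) * (L ^ (2 * kκ + 6) * x ^ (1 - ν)) := by
  have hL0 : 0 < L := by linarith only [hL1]
  set D : ℝ := 3 * L ^ 4 * x ^ (1 - ν) + 4 * κ * x / L ^ Ad + (4 * Real.sqrt (2 * q) + 1) * x ^ (1 - ν) with hD
  have hLA0 : 0 < L ^ Ad := by rw [hLAd]; positivity
  have hD0 : 0 ≤ D := by rw [hD]; positivity
  have hSS : SP * SM ≤ 25 * L ^ (2 * kκ + 2) := by
    have := mul_le_mul hSPle hSMle hSM0 (by positivity)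
    have h2 : 5 * L ^ (kκ + 1) * (5 * L ^ (kκ + 1)) = 25 * L ^ (2 * kκ + 2) := by
      rw [show 2 * kκ + 2 = (kκ + 1) + (kκ + 1) by ring, pow_add]; ring
    linarith only [this, h2.le, h2.ge]
  have h1 : SP * (SM * (K * D)) = (SP * SM) * (K * D) := by ring
  rw [h1]
  have h2 : (SP * SM) * (K * D) ≤ 25 * L ^ (2 * kκ + 2) * (K * D) :=
    mul_le_mul_of_nonneg_right hSS (by positivity)
  refine h2.trans ?_
  have hA : 25 * L ^ (2 * kκ + 2) * (K * (3 * L ^ 4 * x ^ (1 - ν))) = 75 * K * (L ^ (2 * kκ + 6) * x ^ (1 - ν)) := by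
    rw [show 2 * kκ + 6 = (2 * kκ + 2) + 4 by ring, pow_add]; ring
  have hB : 25 * L ^ (2 * kκ + 2) * (K * (4 * κ * x / L ^ Ad)) ≤ 100 * K * (x / L) := by
    have hsplit4 : L ^ (2 * kκ + 4) = L ^ (2 * kκ + 2) * L ^ 2 := by rw [← pow_add]
    have h3 : 25 * L ^ (2 * kκ + 2) * (K * (4 * κ * x / L ^ Ad)) = 100 * K * κ * x / L ^ 2 := by
      rw [hLAd, hsplit4]
      field_simp
      ring
    rw [h3, div_le_iff₀ (by positivity)]
    have h4 : 100 * K * (x / L) * L ^ 2 = 100 * K * x * L := by field_simp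
    rw [h4]
    have h5 : κ * x ≤ 1 * x := mul_le_mul_of_nonneg_right hκ1 hx0.le
    have h6 : x ≤ x * L := le_mul_of_one_le_right hx0.le hL1
    nlinarith only [h5, h6, hK]
  have hC : 25 * L ^ (2 * kκ + 2) * (K * ((4 * Real.sqrt (2 * q) + 1) * x ^ (1 - ν))) ≤
      25 * K * (4 * Real.sqrt (2 * q) + 1) * (L ^ (2 * kκ + 6) * x ^ (1 - ν)) := by
    have h3 : L ^ (2 * kκ + 2) ≤ L ^ (2 * kκ + 6) := pow_le_pow_right₀ hL1 (by omega)
    have h4 : 0 ≤ K * ((4 * Real.sqrt (2 * q) + 1) * x ^ (1 - ν)) := by positivity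
    nlinarith only [h3, h4]
  have hexpand : 25 * L ^ (2 * kκ + 2) * (K * D) =
      25 * L ^ (2 * kκ + 2) * (K * (3 * L ^ 4 * x ^ (1 - ν))) +
      25 * L ^ (2 * kκ + 2) * (K * (4 * κ * x / L ^ Ad)) +
      25 * L ^ (2 * kκ + 2) * (K * ((4 * Real.sqrt (2 * q) + 1) * x ^ (1 - ν))) := by
    rw [hD]; ring
  rw [hexpand, hA]
  have hpos : 0 ≤ L ^ (2 * kκ + 6) * x ^ (1 - ν) := by positivity
  nlinarith only [hB, hC, hpos, hK, Real.sqrt_nonneg (2 * q)]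

end MiddleAssembly

/-- **Auxiliary stub `stub_pair_middle_arith`** (head of this helper file; parent stub `stub_pair_middle`):
the dispersion-part bookkeeping `MiddleAssembly.disp_total_arith` in closed form. -/
theorem stub_pair_middle_arith : ∀ (SP SM K L κ x q ν : ℝ) (kκ : ℕ) (Ad : ℝ), 0 ≤ K → 1 ≤ L → 0 ≤ κ → κ ≤ 1 →
    0 < x → 0 ≤ SM → SP ≤ 5 * L ^ (kκ + 1) → SM ≤ 5 * L ^ (kκ + 1) → L ^ Ad = L ^ (2 * kκ + 4) →
    SP * (SM * (K * (3 * L ^ 4 * x ^ (1 - ν) + 4 * κ * x / L ^ Ad + (4 * Real.sqrt (2 * q) + 1) * x ^ (1 - ν)))) ≤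
      100 * K * (x / L) + (25 * K * (4 + 4 * Real.sqrt (2 * q))) * (L ^ (2 * kκ + 6) * x ^ (1 - ν)) :=
  fun _ _ _ _ _ _ _ _ _ _ hK hL1 hκ0 hκ1 hx0 hSM0 hSPle hSMle hLAd =>
    MiddleAssembly.disp_total_arith hK hL1 hκ0 hκ1 hx0 hSM0 hSPle hSMle hLAd

end Summit.Parity.BatemanHorn.Theorems.PolyMobiusTail.EtaFreeWindow
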